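import Summits.ValiantsHypothesis.ValiantsHypothesis.Theorems.DivisionGapPerDivisionHardStubSparseRigidCount

/-!
# Crux `DivisionGap.PerDivisionHard` (stmt-ValiantsHypothesis-5065), line `pair-descent-jss-endpoint` —
stub `stub_twoSidedCount`: two-sided placement by counting

`stub_twoSidedCount`: given a family of "bad" (row set, column set) pairs `(Tr p, Tc p)`, `p ∈ P`,
of an `n × n` matrix, if
`Σ_{p ∈ P} C(n - |Tr p|, N - |Tr p|) · C(n - |Tc p|, N - |Tc p|) < C(n, N)²`
then some pair `(R, C)` of `N`-sets of rows and columns avoids every bad pair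
(`¬ (Tr p ⊆ R ∧ Tc p ⊆ C)` for all `p ∈ P`).

Proof (the two-sided version of `exists_goodSubset` of `StubSparseRigidCount.lean`).  The pairs
`(R, C)` of `N`-subsets with `Tr p ⊆ R` and `Tc p ⊆ C` form the product of the two superset
families, of cardinality at most `C(n - |Tr p|, N - |Tr p|) · C(n - |Tc p|, N - |Tc p|)`
(`card_supersets_le` on each side with `t₀ = |T|`).  By the union bound
(`Finset.card_biUnion_le`) the bad pairs are fewer than all `C(n, N)²` pairs
(`Finset.card_powersetCard`, `Finset.card_product`), so some pair lies outside
(`Finset.exists_mem_notMem_of_card_lt_card`).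
-/

noncomputable section

-- `Summit.ValiantsHypothesis.ValiantsHypothesis.…` is the tree's mandated single-conjunct layout
-- (Sub = Summit), so the duplicated namespace component is intended.
set_option linter.dupNamespace false

namespace Summit.ValiantsHypothesis.ValiantsHypothesis.Theorems.DivisionGapPerDivisionHard

open scoped BigOperators

/-- **Two-sided placement by counting.**  If
`Σ_{p ∈ P} C(card - |Tr p|, N - |Tr p|) · C(card - |Tc p|, N - |Tc p|) < C(card, N)²`, some pair
`(R, C)` of `N`-subsets satisfies `¬ (Tr p ⊆ R ∧ Tc p ⊆ C)` for every `p ∈ P`. [folklore] -/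
theorem exists_goodPair {α ι : Type*} [Fintype α] [DecidableEq α] (P : Finset ι)
    (Tr Tc : ι → Finset α) (N : ℕ)
    (hcount : (∑ p ∈ P, (Fintype.card α - (Tr p).card).choose (N - (Tr p).card) *
        (Fintype.card α - (Tc p).card).choose (N - (Tc p).card)) <
      (Fintype.card α).choose N * (Fintype.card α).choose N) :
    ∃ R C : Finset α, R.card = N ∧ C.card = N ∧ ∀ p ∈ P, ¬ (Tr p ⊆ R ∧ Tc p ⊆ C) := by
  set S : Finset (Finset α) := Finset.univ.powersetCard N with hSdef
  set U : Finset (Finset α × Finset α) :=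
    P.biUnion fun p => (S.filter fun R => Tr p ⊆ R) ×ˢ (S.filter fun C => Tc p ⊆ C)
  have hS : S.card = (Fintype.card α).choose N := by
    rw [hSdef, Finset.card_powersetCard, Finset.card_univ]
  have hU : U.card < (S ×ˢ S).card := by
    calc U.card
        ≤ ∑ p ∈ P, ((S.filter fun R => Tr p ⊆ R) ×ˢ (S.filter fun C => Tc p ⊆ C)).card :=
          Finset.card_biUnion_le
      _ = ∑ p ∈ P, (S.filter fun R => Tr p ⊆ R).card * (S.filter fun C => Tc p ⊆ C).card :=
          Finset.sum_congr rfl fun p _ => Finset.card_product _ _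
      _ ≤ ∑ p ∈ P, (Fintype.card α - (Tr p).card).choose (N - (Tr p).card) *
            (Fintype.card α - (Tc p).card).choose (N - (Tc p).card) :=
          Finset.sum_le_sum fun p _ => Nat.mul_le_mul
            (card_supersets_le (Tr p) N (Tr p).card le_rfl)
            (card_supersets_le (Tc p) N (Tc p).card le_rfl)
      _ < (Fintype.card α).choose N * (Fintype.card α).choose N := hcount
      _ = (S ×ˢ S).card := by rw [Finset.card_product, hS]
  obtain ⟨RC, hRC, hRCU⟩ := Finset.exists_mem_notMem_of_card_lt_card hU
  obtain ⟨hR, hC⟩ := Finset.mem_product.mp hRC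
  refine ⟨RC.1, RC.2, (Finset.mem_powersetCard.mp hR).2, (Finset.mem_powersetCard.mp hC).2,
    fun p hp h => hRCU ?_⟩
  exact Finset.mem_biUnion.mpr ⟨p, hp, Finset.mem_product.mpr
    ⟨Finset.mem_filter.mpr ⟨hR, h.1⟩, Finset.mem_filter.mpr ⟨hC, h.2⟩⟩⟩

/-- **`stub_twoSidedCount` (registered sub-goal).**  Two-sided placement by counting over the rows
and columns `Fin n` of an `n × n` matrix: if
`Σ_{p ∈ P} C(n - |Tr p|, N - |Tr p|) · C(n - |Tc p|, N - |Tc p|) < C(n, N)²` then some pair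
`(R, C)` of `N`-sets of rows and columns avoids every bad pair `(Tr p, Tc p)`. [folklore] -/
theorem stub_twoSidedCount :
    ∀ (n N : ℕ) (ι : Type) (P : Finset ι) (Tr Tc : ι → Finset (Fin n)),
      (∑ p ∈ P, (n - (Tr p).card).choose (N - (Tr p).card) *
          (n - (Tc p).card).choose (N - (Tc p).card)) < n.choose N * n.choose N →
      ∃ R C : Finset (Fin n), R.card = N ∧ C.card = N ∧ ∀ p ∈ P, ¬ (Tr p ⊆ R ∧ Tc p ⊆ C) := by
  intro n N ι P Tr Tc hcount
  exact exists_goodPair P Tr Tc N (by simpa only [Fintype.card_fin] using hcount)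

end Summit.ValiantsHypothesis.ValiantsHypothesis.Theorems.DivisionGapPerDivisionHard

end
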